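import Literature.MathematicalPhysics.QuantumFieldTheory.Balaban1983to89.B8SectEInLambdaWitness
import Literature.MathematicalPhysics.QuantumFieldTheory.Balaban1983to89.B7Prop10InLambda

/-!
# `Balaban1983to89.B8SectERemainderCovariance` — [Balaban1985Averaging] (78)–(80) p. 30, (178)–(179) p. 45, (211)–(213) p. 50 /
# [Balaban1985RegularSpaces] (1.115) p. 96: THE `U(N)`-COVARIANCE OF THE AVERAGING OPERATIONS UNDER `w ↦ (w⋆)⁻¹` AND OF THE SECT.-E
# REMAINDER `C′_j(u₁, ·)` UNDER `μ ↦ −μ⋆` — the displayed law `hCequiv` of the Theorem-4 JOIN (`B8Prop5JoinSectE`), proved, tower-locally and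
# for the inverse `u₁⁻¹` of Theorem 4's inductive gauge transformation from the original pair's regime

statement-level skeleton of published theorems with citation tags; proofs where landed; nothing here is a claim about the Yang–Mills mass gap

T. Bałaban, *Averaging operations for lattice gauge theories*, Commun. Math. Phys. **98** (1985) 17–51 `[Balaban1985Averaging]` ([3]),
(21)–(23) p. 21, (56)–(58) p. 27, (78)–(80) p. 30, (166)–(167) p. 44, (178)–(179) p. 45, Prop. 10 (203)–(214) p. 50; T. Bałaban, *Spaces of
regular gauge field configurations on a lattice and gauge fixing conditions*, Commun. Math. Phys. **99** (1985) 75–102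
`[Balaban1985RegularSpaces]` ("B8"), (1.115)–(1.121) p. 96, p. 93 («we consider configurations λ with values in the complexified algebra»).
PDF held: `paper:balaban1985-cmp99-regular-spaces-gauge-fixing`.  STATUS: published, refereed.

CITATION HEADER (lean-in-tree rule).  Cell `pub-ymgap` (YM Track A, DAG node N05 = [B8], HUMAN RULING D-0062), seat `pub-ymgap-dag-n04-b`
gen 3 (INTENT-3).  WHY THIS FILE.  The JOIN `B8Prop5JoinSectE.hFP_kLevel_of_sectE` (dag-n19-b, p435517) derives the REALITY of Sect. E's
`D′(u₁⁻¹, −iλ)` by uniqueness from two DISPLAYED covariance laws: `hHequiv` for the letter `H′` of [4], and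
`hCequiv : C′_j(u₁⁻¹, −μ⋆)(y) = −C′_j(u₁⁻¹, μ)(y)⋆` for the CONCRETE remainder `C′ = B8Eq1123Concrete.Cnl` on the (1.120)-set of the tower
(«true in the unitary setting, not proved here», INBOX l.11628).  Print works in `G = U(N)` with `λ` in the COMPLEXIFIED Lie algebra (p. 93)
and never states the law; it holds because every averaging operation of [3] — the site average (78) (`exp` of a real mean of `log`s), the
rotations (56)/(58) by the unitary background transporters, the iterated averages (79)/(80), the relative averages (178)/(179) and the linear
`Q′_j` (211)–(213) — is covariant under the involution `θ(w) = (w⋆)⁻¹` of the unit group (which fixes the unitaries and satisfies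
`log θ(W) = −(log W)⋆` on the domain of the logarithm), resp. under `m ↦ m⋆`.  THIS FILE proves the law: globally ([3]'s currency), on the
tower for any `u` with a UNITARY `Λ_j`-witness (`B8SectEInLambdaWitness`), and AT `u₁⁻¹` for Theorem 4's inductive `u₁` from the original
pair's regime — exactly the binder `hCequiv` of `hFP_kLevel_of_sectE`, as a theorem.  Kind «kernel-checked proof», theorems only: no `def`
(`θ` is written out as `(star w)⁻¹`), no `… : Prop` fact, no existing module modified.  REUSED BY NAME: p05 `B8Eq1112Quotient.{uavg_inv,
inLambda_inv}`-style induction over (79)/(80) (`B7Eq84Concrete.uavg_succ`, `B7Eq99Concrete.{R0avg, savg, Sexp, R0fun}`), `B9Eq3114Proof.mlog_units_inv`,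
`B7BlockAvgLog.mlog_exp`, `MatrixLog.{exp_mlog, norm_mlog_le_two_mul}`, Mathlib `NormedSpace.star_exp`, `B7Prop6Flat.norm_units_inv_sub_one_le`,
`B7Prop8PrintedConstants.uavg_mem_unitaryUnits`, r04 `B7Prop10General.prop10_general_of52`, `B7Prop10InLambda.inLambda_mul_of_prop10_general`,
`B8Eq178Averages.{utilG_eq_uavg_mul_inv, Qnl_eq_mlog_utilG, qprimeIter_bgT_eq_lamAvgG}`, this seat's `B8SectEInLambdaWitness.witness_unitary_of_glev`,
`B8Eq1117KLevel.glev_on_towers_of_axial`, `B8Eq1115Concrete.{utilG_congr_tower, lamAvgG_congr_tower}`.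

## WHAT IS CERTIFIED HERE (kernel; axioms `propext` / `Classical.choice` / `Quot.sound`), `𝔸` a C⋆-algebra

* §1 algebra of `θ(w) = (star w)⁻¹` on `𝔸ˣ` (private): multiplicative, commutes with `R(h)` for unitary `h`, `θ(e^S) = e^{−S⋆}`,
  `log θ(W) = −(log W)⋆` for `‖W − 1‖ ≤ 1/8`; `star (cj h m) = cj h (star m)` for unitary `h`; real scalars commute with `star`.
* §2 `Sexp_theta`, `savg_theta`, `R0avg_theta`, **`uavg_theta`** (`\overline{R₀(θ∘u)}ʲ = θ ∘ \overline{R₀u}ʲ` under (167) for `u` at unitary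
  levels), **`utilG_theta`** (`ũ′ʲ` for `(θ∘u′, u)` is `θ ∘ ũ′ʲ` for unitary `u`), **`lamAvgG_negStar`** (`Q′_j(−μ⋆) = −(Q′_jμ)⋆`).
* §3 **`Cnl_negStar`** — GLOBAL: `C′_j(u, −μ⋆)(z) = −C′_j(u, μ)(z)⋆` for unitary `u ∈ Λ_k(U₀, α₃)`, (207)-small `μ`, unitary levels.
* §4 **`Cnl_negStar_of_witness`** — on the tower for any `u` with a unitary `Λ_j`-witness; **`Cnl_negStar_inv_of_axial`** — AT `u₁⁻¹` for Theorem
  4's inductive `u₁` (`InAx` + `Restr129`, (1.33), (1.69), unitarity, full-field regularity, windows): LITERALLY the binder `hCequiv` of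
  `B8Prop5JoinSectE.hFP_kLevel_of_sectE`.

## HONEST SCOPE — what is NOT claimed

(i) The law for the letter `H′` of [4] (`hHequiv`) is b9's, not here.  (ii) Windows are the lineage's (Prop-10's at `4α₄`, `2C₆(α₃ + 4α₄) ≤ 1/8`,
`4C₆α₄ ≤ 1/8`), merely sufficient.  (iii) Unitary data throughout (print `G ⊂ U(N)`).  Count-neutral; N05 NOT discharged; nothing continuum / ℝ⁴ / OS /
mass-gap / Clay.
-/

noncomputable section

open NormedSpace Finset

namespace Literature.MathematicalPhysics.QuantumFieldTheory.Balaban1983to89.B8SectERemainderCovariance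

open B7Prop1Explicit B7Prop2Explicit B7Prop3Flat B7Prop1Local B7Eq167Flat B7Eq167General
open MatrixLog (mlog exp_mlog norm_mlog_le_two_mul)
open B7Eq170Flat (cj cj_apply val_Rc_eq_cj bmean bmean_apply)
open B7Eq92Concrete (Rc Rc_apply mgauge)
open B7Eq99Concrete (R0fun R0fun_apply R0fun_self R0fun_add R0avg savg Sexp savg_apply Sexp_apply)
open B7Eq84Concrete (uavg uavg_zero uavg_succ glev)
open B7Prop9Flat (C5' SiteBd)
open B7Prop9General (CovBondBd)
open B7Prop10General (C6 C4G utilG prop10_general_of52 levels_of52)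
open B7Prop10Flat (one_le_C5 C4'_nonneg C5'_nonneg)
open B7Prop10InLambda (inLambda_mul_of_prop10_general)
open B7Eq214General (rlam rlam_apply lamAvgG lamAvgG_zero lamAvgG_succ)
open B7Prop8PrintedConstants (uavg_mem_unitaryUnits)
open B8Ineq130 (tlo thi inBox_of_le tlo_zero thi_zero)
open B8Eq1115Concrete (utilG_congr_tower lamAvgG_congr_tower)
open B8Eq119TwistedAxial (bgT InAx Restr129)
open B8Eq178Averages (Qnl Qnl_eq_mlog_utilG qprimeIter_bgT_eq_lamAvgG utilG_eq_uavg_mul_inv)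
open B8Eq1123Concrete (Cnl)
open B8Eq1112Quotient (inLambda_inv)
open B9Eq3114Proof (mlog_units_inv)
open B8SectEInLambdaWitness (witness_unitary_of_glev)
open B8Eq1117KLevel (glev_on_towers_of_axial)

-- `Site` alone could resolve to the torus sites of `Setup.lean`; re-export the `ℤ^d` sites of `B7Prop1Explicit`.
export B7Prop1Explicit (Site)

variable {d : ℕ}
variable {𝔸 : Type*} [CStarAlgebra 𝔸]

/-! ## §1 The involution `θ(w) = (w⋆)⁻¹` of the unit group and the logarithm -/

section Theta

omit [CStarAlgebra 𝔸] in
/-- `θ` is multiplicative: `((ab)⋆)⁻¹ = (a⋆)⁻¹(b⋆)⁻¹`. [folklore] -/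
private theorem thetaU_mul {𝔹 : Type*} [Monoid 𝔹] [StarMul 𝔹] (a b : 𝔹ˣ) : (star (a * b))⁻¹ = (star a)⁻¹ * (star b)⁻¹ := by
  rw [star_mul, mul_inv_rev]

omit [CStarAlgebra 𝔸] in
/-- `θ` commutes with inversion: `((a⁻¹)⋆)⁻¹ = ((a⋆)⁻¹)⁻¹`. [folklore] -/
private theorem thetaU_inv {𝔹 : Type*} [Monoid 𝔹] [StarMul 𝔹] (a : 𝔹ˣ) : (star a⁻¹)⁻¹ = ((star a)⁻¹)⁻¹ :=
  Units.ext (by rw [inv_inv, Units.coe_star, Units.coe_star_inv, inv_inv])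

/-- A unitary unit has `h⋆ = h⁻¹` in `𝔸ˣ`. [folklore] -/
private theorem star_eq_inv_of_mem {h : 𝔸ˣ} (hh : h ∈ unitaryUnits 𝔸) : star h = h⁻¹ :=
  Units.ext (by
    rw [Units.coe_star]
    exact (Units.inv_eq_of_mul_eq_one_left (Unitary.star_mul_self_of_mem (mem_unitaryUnits.1 hh))).symm)

/-- `θ` commutes with the rotation (56) by a UNITARY `h`: `((hwh⁻¹)⋆)⁻¹ = h(w⋆)⁻¹h⁻¹`. [cite: Balaban1985Averaging, (56)–(57) p.27] -/
private theorem thetaU_Rc {h : 𝔸ˣ} (hh : h ∈ unitaryUnits 𝔸) (w : 𝔸ˣ) : (star (Rc h w))⁻¹ = Rc h (star w)⁻¹ := by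
  rw [Rc_apply, Rc_apply, star_mul, star_mul, mul_inv_rev, mul_inv_rev, star_eq_inv_of_mem ((unitaryUnits 𝔸).inv_mem hh),
    star_eq_inv_of_mem hh, inv_inv]

/-- `θ(e^S) = e^{−S⋆}` (`NormedSpace.star_exp`). [cite: Balaban1985Averaging, (22)–(23) p.21] -/
private theorem thetaU_expUnit (S : 𝔸) : (star (expUnit S))⁻¹ = expUnit (-star S) :=
  Units.ext (by rw [Units.coe_star_inv, val_inv_expUnit, val_expUnit, val_expUnit, star_exp, star_neg])

/-- `log θ(W) = −(log W)⋆` on the domain of the logarithm: for a unit `W` with `‖W − 1‖ ≤ 1/8`, `log((W⋆)⁻¹) = log((W⁻¹)⋆) = (log W⁻¹)⋆ =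
−(log W)⋆` — the series (21) commutes with `⋆` (via `e^{(log X)⋆} = (e^{log X})⋆ = X⋆` and `log ∘ exp = id` on `‖·‖ < ln 2`) and
`log X⁻¹ = −log X`. [cite: Balaban1985Averaging, (21)–(23) p.21] -/
private theorem mlog_thetaU {W : 𝔸ˣ} (hW : ‖(W : 𝔸) - 1‖ ≤ 1 / 8) :
    mlog (((star W)⁻¹ : 𝔸ˣ) : 𝔸) = -star (mlog (W : 𝔸)) := by
  have hWinv : ‖((W⁻¹ : 𝔸ˣ) : 𝔸) - 1‖ ≤ 1 / 4 :=
    (B7Prop6Flat.norm_units_inv_sub_one_le W (hW.trans (by norm_num))).trans (by linarith)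
  set X : 𝔸 := ((W⁻¹ : 𝔸ˣ) : 𝔸) with hX
  have hX1 : ‖X - 1‖ < 1 := lt_of_le_of_lt hWinv (by norm_num)
  have hlogX : ‖mlog X‖ ≤ 1 / 2 := (norm_mlog_le_two_mul (hWinv.trans (by norm_num))).trans (by linarith)
  have hlog2 : (1 : ℝ) / 2 < Real.log 2 := by have := Real.log_two_gt_d9; linarith
  -- `log X⋆ = (log X)⋆`
  have hstar : mlog (star X) = star (mlog X) := by
    have h2 : star X = exp (star (mlog X)) := by rw [← star_exp, exp_mlog hX1]
    rw [h2]
    exact B7BlockAvgLog.mlog_exp (by rw [norm_star]; exact lt_of_le_of_lt hlogX hlog2)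
  rw [Units.coe_star_inv, hstar, hX, mlog_units_inv (lt_of_le_of_lt hW (by norm_num)), star_neg]

/-- `⋆` commutes with the rotation `cj h m = h m h⁻¹` by a UNITARY `h`. [cite: Balaban1985Averaging, (56) p.27] -/
private theorem star_cj {h : 𝔸ˣ} (hh : h ∈ unitaryUnits 𝔸) (m : 𝔸) : star (cj h m) = cj h (star m) := by
  have h1 : star ((h : 𝔸ˣ) : 𝔸) = ((h⁻¹ : 𝔸ˣ) : 𝔸) := by
    rw [← Units.coe_star, star_eq_inv_of_mem hh]
  have h2 : star ((h⁻¹ : 𝔸ˣ) : 𝔸) = ((h : 𝔸ˣ) : 𝔸) := by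
    rw [← Units.coe_star, star_eq_inv_of_mem ((unitaryUnits 𝔸).inv_mem hh), inv_inv]
  rw [cj_apply, cj_apply, star_mul, star_mul, h1, h2, mul_assoc]

omit [CStarAlgebra 𝔸] in
/-- Real scalars commute with `⋆`. [folklore] -/
private theorem star_smul_real_cstar {𝔹 : Type*} [CStarAlgebra 𝔹] (c : ℝ) (m : 𝔹) : star (c • m) = c • star m := by
  rw [RCLike.real_smul_eq_coe_smul (K := ℂ) c m, RCLike.real_smul_eq_coe_smul (K := ℂ) c (star m), star_smul, RCLike.star_def,
    RCLike.conj_ofReal]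

end Theta

/-! ## §2 Covariance of the averaging operations (78)–(80), (178)–(179), (211)–(213) of [3] -/

section Averaging

variable {L : ℕ}

/-- **The exponent of (78) for `θ∘g` is `−(S_g)⋆`**: `S_{θ∘g}(y) = Σ_x L^{−d} log θ(g(y)⁻¹g(x)) = −(S_g(y))⋆`, when every
`‖g(y)⁻¹g(x) − 1‖ ≤ 1/8` on the block. [cite: Balaban1985Averaging, (78) p.30, (21) p.21] -/
theorem Sexp_theta {g : Site d → 𝔸ˣ} {y : Site d}
    (hW : ∀ r : Fin d → Fin L, ‖((((g y)⁻¹ * g (y + boxVec L r) : 𝔸ˣ)) : 𝔸) - 1‖ ≤ 1 / 8) :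
    Sexp L (fun x => (star (g x))⁻¹) y = -star (Sexp L g y) := by
  rw [Sexp_apply, Sexp_apply, star_sum, ← sum_neg_distrib]
  refine sum_congr rfl fun r _ => ?_
  have hgrp : ((star (g y))⁻¹)⁻¹ * (star (g (y + boxVec L r)))⁻¹ = (star ((g y)⁻¹ * g (y + boxVec L r)))⁻¹ := by
    rw [thetaU_mul, thetaU_inv]
  rw [hgrp, mlog_thetaU (hW r), star_smul_real_cstar, smul_neg]

/-- **The site average (78) is `θ`-covariant**: `{θ∘g}_{B(y)} = θ({g}_{B(y)})` (`g(y)e^{S} ↦ θ(g(y))e^{−S⋆} = θ(g(y)e^{S})`), on the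
domain of the logarithms. [cite: Balaban1985Averaging, (78) p.30] -/
theorem savg_theta {g : Site d → 𝔸ˣ} {y : Site d}
    (hW : ∀ r : Fin d → Fin L, ‖((((g y)⁻¹ * g (y + boxVec L r) : 𝔸ˣ)) : 𝔸) - 1‖ ≤ 1 / 8) :
    savg L (fun x => (star (g x))⁻¹) y = (star (savg L g y))⁻¹ := by
  rw [savg_apply, savg_apply, Sexp_theta hW, thetaU_mul, thetaU_expUnit]

/-- **The rotated field `R_{0,y}v` of (78)/(79) is `θ`-covariant at a UNITARY background** (the transporters `V₀(Γ_{y,x})` are unitary):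
`R_{0,y}(θ∘v) = θ ∘ R_{0,y}v`. [cite: Balaban1985Averaging, p.27 (display after (59)), (56)–(58) p.27] -/
theorem R0fun_theta {V₀ : Site d → Fin d → 𝔸ˣ} (hV : ∀ x κ, V₀ x κ ∈ unitaryUnits 𝔸) (y : Site d) (v : Site d → 𝔸ˣ) :
    R0fun V₀ y (fun x => (star (v x))⁻¹) = fun x => (star (R0fun V₀ y v x))⁻¹ := by
  funext x
  rw [R0fun_apply, R0fun_apply, thetaU_Rc (hol_mem_of hV _ _)]

/-- **The twisted site average (78)/(79) `R̄₀v` is `θ`-covariant at a unitary background**, on the domain of the logarithms (the block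
quantities `v(y)⁻¹(R_{0,y}v)(x)` of (167) within `1/8` of `1`). [cite: Balaban1985Averaging, (78)–(79) p.30] -/
theorem R0avg_theta {V₀ : Site d → Fin d → 𝔸ˣ} (hV : ∀ x κ, V₀ x κ ∈ unitaryUnits 𝔸) {v : Site d → 𝔸ˣ} {y : Site d}
    (hW : ∀ r : Fin d → Fin L, ‖((((v y)⁻¹ * R0fun V₀ y v (y + boxVec L r) : 𝔸ˣ)) : 𝔸) - 1‖ ≤ 1 / 8) :
    R0avg L V₀ (fun x => (star (v x))⁻¹) y = (star (R0avg L V₀ v y))⁻¹ := by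
  rw [R0avg, R0avg, R0fun_theta hV]
  refine savg_theta (g := R0fun V₀ y v) fun r => ?_
  rw [R0fun_self]
  exact hW r

variable {U₀ : Site d → Fin d → 𝔸ˣ} {u u' : Site d → 𝔸ˣ} {k : ℕ} {β β' η : ℝ}

/-- **The `k`-th order averages (79)–(80) are `θ`-covariant**: `\overline{R₀(θ∘u)}ʲ = θ ∘ \overline{R₀u}ʲ`, `j ≤ k`, for `u` satisfying (167)
with `βLᵏη ≤ 1/8` at a background with UNITARY averaged levels `Ū₀ʲ` (`j < k`) — the logarithms of (80) are taken of exactly the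
(167)-quantities ([3] p. 44), which lie in the domain where `log θ(W) = −(log W)⋆`. [cite: Balaban1985Averaging, (79)–(80) p.30, (167) p.44] -/
theorem uavg_theta (hV : ∀ j < k, ∀ (x : Site d) (κ : Fin d), avgIter L U₀ j x κ ∈ unitaryUnits 𝔸)
    (h167 : Cond167 L U₀ u k β η) (hL : 1 ≤ L) (hη : 0 ≤ η) (hβ : 0 ≤ β) (hs : β * (L : ℝ) ^ k * η ≤ 1 / 8) :
    ∀ j ≤ k, uavg L U₀ (fun x => (star (u x))⁻¹) j = fun z => (star (uavg L U₀ u j z))⁻¹ := by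
  have hLr : (1 : ℝ) ≤ L := by exact_mod_cast hL
  intro j
  induction j with
  | zero => intro _; rfl
  | succ j ih =>
    intro hjk
    have hjlt : j < k := Nat.lt_of_succ_le hjk
    funext z
    rw [uavg_succ, ih hjlt.le, uavg_succ]
    refine R0avg_theta (hV j hjlt) fun r => ?_
    rw [R0fun_add]
    calc ‖((((uavg L U₀ u j ((L : ℤ) • z))⁻¹ *
          Rc (hol (avgIter L U₀ j) ((L : ℤ) • z) (treeWord (boxVec L r)))
            (uavg L U₀ u j ((L : ℤ) • z + boxVec L r)) : 𝔸ˣ)) : 𝔸) - 1‖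
        ≤ β * (L : ℝ) ^ (j + 1) * η := h167 j hjlt z r
      _ ≤ β * (L : ℝ) ^ k * η :=
        mul_le_mul_of_nonneg_right (mul_le_mul_of_nonneg_left (pow_le_pow_right₀ hLr hjk) hβ) hη
      _ ≤ 1 / 8 := hs

/-- **The relative averages `ũ′ʲ` of (178)/(179) are `θ`-covariant in `u′` for a UNITARY `u`**: `ũ′ʲ[θ∘u′, u] = θ ∘ ũ′ʲ[u′, u]`, `j ≤ k` —
by (178) `ũ′ʲ = \overline{R₀u′u}ʲ(\overline{R₀u}ʲ)⁻¹` (`utilG_eq_uavg_mul_inv`), `uavg_theta` for the product `u′u` ((167) with constant `β′`)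
and the unitarity of `\overline{R₀u}ʲ` (`uavg_mem_unitaryUnits`, (167) for `u` with `β`; `θ` fixes unitaries).
[cite: Balaban1985Averaging, (178)–(179) p.45, (79)–(80) p.30] -/
theorem utilG_theta (hV : ∀ j < k, ∀ (x : Site d) (κ : Fin d), avgIter L U₀ j x κ ∈ unitaryUnits 𝔸)
    (hu : ∀ x, u x ∈ unitaryUnits 𝔸) (h167 : Cond167 L U₀ u k β η) (h167' : Cond167 L U₀ (u' * u) k β' η)
    (hL : 1 ≤ L) (hη : 0 ≤ η) (hβ : 0 ≤ β) (hβ' : 0 ≤ β') (hs : β * (L : ℝ) ^ k * η ≤ 1 / 4) (hs' : β' * (L : ℝ) ^ k * η ≤ 1 / 8) :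
    ∀ j ≤ k, ∀ z : Site d, utilG L U₀ (fun x => (star (u' x))⁻¹) u j z = (star (utilG L U₀ u' u j z))⁻¹ := by
  intro j hj z
  have hprod : (fun x => (star (u' x))⁻¹) * u = fun x => (star ((u' * u) x))⁻¹ := by
    funext x
    rw [Pi.mul_apply, Pi.mul_apply, thetaU_mul, star_eq_inv_of_mem (hu x), inv_inv]
  have hun : star (uavg L U₀ u j z) = (uavg L U₀ u j z)⁻¹ :=
    star_eq_inv_of_mem (uavg_mem_unitaryUnits hV hu h167 hL hη hβ hs j hj z)
  rw [congrFun (utilG_eq_uavg_mul_inv L U₀ _ u j) z, congrFun (utilG_eq_uavg_mul_inv L U₀ u' u j) z, hprod,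
    congrFun (uavg_theta hV h167' hL hη hβ' hs' j hj) z, thetaU_mul, thetaU_inv, hun, inv_inv]

/-- **The linear averaging `Q′_j` of (211)–(213) satisfies `Q′_j(−μ⋆) = −(Q′_jμ)⋆`** at a background with unitary averaged levels: real
weights and rotations `R(Ū₀ʲ(Γ))` by unitaries commute with `m ↦ −m⋆`. [cite: Balaban1985Averaging, (211)–(213) p.50, (56) p.27] -/
theorem lamAvgG_negStar (hV : ∀ j < k, ∀ (x : Site d) (κ : Fin d), avgIter L U₀ j x κ ∈ unitaryUnits 𝔸) (f : Site d → 𝔸) :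
    ∀ j ≤ k, lamAvgG L U₀ j (fun x => -star (f x)) = fun z => -star (lamAvgG L U₀ j f z) := by
  intro j
  induction j with
  | zero => intro _; rfl
  | succ j ih =>
    intro hjk
    have hjlt : j < k := Nat.lt_of_succ_le hjk
    funext z
    rw [lamAvgG_succ, ih hjlt.le, lamAvgG_succ, rlam_apply, rlam_apply, bmean_apply, bmean_apply, star_sum, ← sum_neg_distrib]
    refine sum_congr rfl fun r _ => ?_
    rw [B7Eq170Flat.cj_neg, star_smul_real_cstar, star_cj (hol_mem_of (hV j hjlt) _ _), smul_neg]

end Averaging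

/-! ## §3 The Sect.-E remainder `C′_j(u, ·)` under `μ ↦ −μ⋆`, global form -/

section Global

variable {L : ℕ} {U₀ : Site d → Fin d → 𝔸ˣ} {u : Site d → 𝔸ˣ} {k : ℕ} {β β' η : ℝ} {μ : Site d → 𝔸}

/-- **`C′_j(u, −μ⋆)(z) = −C′_j(u, μ)(z)⋆`, GLOBAL FORM** — for a UNITARY `u` with (167) (constant `β`, `βLᵏη ≤ ¼`), the product `e^{μ}u` with
(167) (constant `β′`, `β′Lᵏη ≤ 1/8`), unitary averaged levels of `U₀`, and the relative averages `ũ′ʲ(z)` of `(e^{μ}, u)` within `1/8` of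
`1` ((204)): since `e^{−μ⋆} = θ ∘ e^{μ}` pointwise, `C′_j(u, −μ⋆) = log θ(ũ′ʲ) − Q′_j(−μ⋆) = −(log ũ′ʲ)⋆ + (Q′_jμ)⋆ = −C′_j(u, μ)⋆`
(`C′_j(u, μ) = log ũ′ʲ − Q′_jμ`, (213)). [cite: Balaban1985RegularSpaces, (1.115) p.96; Balaban1985Averaging, (213) p.50, (178)–(179) p.45] -/
theorem Cnl_negStar (hV : ∀ j < k, ∀ (x : Site d) (κ : Fin d), avgIter L U₀ j x κ ∈ unitaryUnits 𝔸)
    (hu : ∀ x, u x ∈ unitaryUnits 𝔸) (h167 : Cond167 L U₀ u k β η)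
    (h167' : Cond167 L U₀ ((fun x => expUnit (μ x)) * u) k β' η)
    (hL : 1 ≤ L) (hη : 0 ≤ η) (hβ : 0 ≤ β) (hβ' : 0 ≤ β') (hs : β * (L : ℝ) ^ k * η ≤ 1 / 4) (hs' : β' * (L : ℝ) ^ k * η ≤ 1 / 8)
    (h204 : ∀ j ≤ k, ∀ z : Site d, ‖((utilG L U₀ (fun x => expUnit (μ x)) u j z : 𝔸ˣ) : 𝔸) - 1‖ ≤ 1 / 8) :
    ∀ j ≤ k, ∀ z : Site d, Cnl L U₀ u j (fun x => -star (μ x)) z = -star (Cnl L U₀ u j μ z) := by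
  intro j hj z
  have hexp : (fun x => expUnit (-star (μ x))) = fun x => (star ((fun x => expUnit (μ x)) x))⁻¹ :=
    funext fun x => (thetaU_expUnit (μ x)).symm
  simp only [Cnl, Qnl_eq_mlog_utilG, qprimeIter_bgT_eq_lamAvgG]
  rw [hexp, utilG_theta hV hu h167 h167' hL hη hβ hβ' hs hs' j hj z, mlog_thetaU (h204 j hj z),
    congrFun (lamAvgG_negStar hV μ j hj) z, star_sub]
  abel

end Global

/-! ## §4 On the tower from a unitary `Λ_j`-witness; at `u₁⁻¹` for Theorem 4's inductive `u₁` -/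

section Tower

variable [Nontrivial 𝔸]
variable {L : ℕ} {j : ℕ} {y : Site d} {U₀ : Site d → Fin d → 𝔸ˣ} {α₀ α₃ α₄ : ℝ} {μ : Site d → 𝔸} {u ut : Site d → 𝔸ˣ}

/-- **`C′_j(u, −μ⋆)(y′) = −C′_j(u, μ)(y′)⋆` ON THE TOWER FOR ANY `u` WITH A UNITARY `Λ_j`-WITNESS** — at every level-`m` site `z` of `Bⁿ(y)`
(`n + m = j`), for `μ` with (207) on `Bʲ(y)` (`‖μ‖ < α₄`, covariant differences `< α₄L^{−j}`), `U₀` unitary with (1.33) on `Bʲ(y)`, and r04's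
Prop-10 windows at `(α₃, 4α₄)` with `2C₆(α₃ + 4α₄) ≤ 1/8`, `4C₆α₄ ≤ 1/8`: the global law `Cnl_negStar` for the clamped data `(π^*U₀, μ∘π, ũ)`
(unitary levels by Prop. 2, (167) for `ũ` and for `e^{μ∘π}ũ` by [3] p. 45, (204) by Prop. 10), transferred by the locality of `ũ′ᵐ` and `Q′_m`.
[cite: Balaban1985RegularSpaces, (1.115) p.96, (1.120) p.96; Balaban1985Averaging, Prop. 10 p.50, (166)–(167) p.44] -/
theorem Cnl_negStar_of_witness (hL : 2 ≤ L) (hU₀ : ∀ x κ, U₀ x κ ∈ unitaryUnits 𝔸)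
    (hα : 0 < α₀) (hα3 : C0 d * α₀ ≤ 1 / 3) (hα2 : 2 * α₀ ≤ c2' d L)
    (h33 : pdevOn (tlo L y j) (thi L y j) U₀ < α₀ * (((L : ℝ) ^ j)⁻¹) ^ 2) (hL1 : 1 ≤ L)
    (hut : ∀ x, ut x ∈ unitaryUnits 𝔸)
    (hW : InLambda L (clampCfg (tlo L y j) (thi L y j) U₀) ut j α₃ (((L : ℝ) ^ j)⁻¹))
    (hu : ∀ x : Site d, tlo L y j ≤ x → x ≤ thi L y j → u x = ut x)
    (hα₄ : 0 < α₄) (h177b : ∀ x : Site d, InBox (tlo L y j) (thi L y j) x → ‖μ x‖ < α₄)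
    (h177a : ∀ (x : Site d) (κ : Fin d), InBox (tlo L y j) (thi L y j) x → InBox (tlo L y j) (thi L y j) (x + e κ) →
      ‖cj (U₀ x κ) (μ (x + e κ)) - μ x‖ < α₄ * ((L : ℝ) ^ j)⁻¹)
    (hα₃ : 0 ≤ α₃) (hα₃' : α₃ ≤ 1 / 50)
    (hs₁ : 10 * C6 d * (4 * α₄) ≤ 1) (hs₂ : 3000 * ((d : ℝ) + 1) * L * (4 * α₄) ≤ 1) (hs₃ : C4G d L * (α₀ + α₃ + 4 * α₄) ≤ 1)
    (hs₄ : 1024 * ((d : ℝ) + 1) * ((d : ℝ) + 4) * L ^ 2 * α₀ ≤ 1) (hs₅ : 32 * ((d : ℝ) + 1) ^ 2 * C6 d * L ^ 2 * α₀ ≤ 1)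
    (hs₆ : 16 * d * C5' d * C6 d * (L : ℝ) ^ 2 * α₀ ≤ 1)
    (hprod : 2 * C6 d * (α₃ + 4 * α₄) ≤ 1 / 8) (h204w : C6 d * (4 * α₄) ≤ 1 / 8)
    {m n : ℕ} (hmn : n + m = j) (z : Site d) (hz : tlo L y n ≤ z) (hz' : z ≤ thi L y n) :
    Cnl L U₀ u m (fun x => -star (μ x)) z = -star (Cnl L U₀ u m μ z) := by
  have hG := avgClosed_unitaryUnits d L (𝔸 := 𝔸)
  have hlohi : ∀ i, tlo L y j i ≤ thi L y j i := B8Ineq130.tlo_le_thi hL1 le_rfl j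
  have hUU : ∀ x κ, U₀ x κ ∈ U1 𝔸 := fun x κ => unitaryUnits_le_U1 (hU₀ x κ)
  have hLr : (1 : ℝ) ≤ L := by exact_mod_cast hL1
  have hLj : (0 : ℝ) < (L : ℝ) ^ j := by positivity
  have hC6 : (2 : ℝ) ≤ C6 d := by unfold C6; linarith [one_le_C5 (d := d)]
  have hα₄' : α₄ ≤ 1 / 4 := by nlinarith
  -- the extended data
  set U₀c := clampCfg (tlo L y j) (thi L y j) U₀ with hU₀c_def
  set μc : Site d → 𝔸 := fun x => μ (clamp (tlo L y j) (thi L y j) x) with hμc_def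
  have hU₀c : ∀ x κ, U₀c x κ ∈ unitaryUnits 𝔸 := clampCfg_mem hU₀
  have h52c : pdev U₀c < α₀ * (((L : ℝ) ^ j)⁻¹) ^ 2 := (pdev_clampCfg_le hlohi hUU).trans_lt h33
  have h₀ : AgreeOn (tlo L y j) (thi L y j) U₀ U₀c := (clampCfg_agree U₀).symm
  -- unitary averaged levels of the clamped background (Prop. 2 of [3])
  have hV : ∀ i < j, ∀ (x : Site d) (κ : Fin d), avgIter L U₀c i x κ ∈ unitaryUnits 𝔸 := fun i hi x κ =>
    (prop2_unitaryUnits L hL j U₀c hU₀c hα hα3 hα2 h52c).2 i hi.le x κ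
  -- (167) for the witness and for the product `e^{μ∘π}·ũ`; (204) for `(e^{μ∘π}, ũ)`
  have hη : (0 : ℝ) ≤ ((L : ℝ) ^ j)⁻¹ := by positivity
  have hk : (L : ℝ) ^ j * ((L : ℝ) ^ j)⁻¹ ≤ 1 := by rw [mul_inv_cancel₀ hLj.ne']
  obtain ⟨h176, h177⟩ : SiteBd (fun x => expUnit (μc x)) (4 * α₄) ∧ CovBondBd U₀c (fun x => expUnit (μc x)) (4 * α₄ * ((L : ℝ) ^ j)⁻¹) := by
    have hη1 : ((L : ℝ) ^ j)⁻¹ ≤ 1 := inv_le_one_of_one_le₀ (one_le_pow₀ hLr)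
    have hb : ∀ x : Site d, ‖μc x‖ < α₄ := fun x => h177b _ (clamp_inBox hlohi x)
    have ha : ∀ (x : Site d) (κ : Fin d), ‖cj (U₀c x κ) (μc (x + e κ)) - μc x‖ < α₄ * ((L : ℝ) ^ j)⁻¹ := by
      intro x κ
      by_cases hP : tlo L y j κ ≤ x κ ∧ x κ < thi L y j κ
      · have hx := clamp_inBox hlohi x
        have hxe : InBox (tlo L y j) (thi L y j) (clamp (tlo L y j) (thi L y j) x + e κ) := by
          rw [← clamp_add_e_of hP]; exact clamp_inBox hlohi _
        simp only [hμc_def, hU₀c_def, clampCfg, hP, and_self, if_true, clamp_add_e_of hP]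
        exact h177a _ κ hx hxe
      · simp only [hμc_def, hU₀c_def, clampCfg, hP, if_false, clamp_add_e_of_not (hlohi κ) hP, cj_apply, Units.val_one, inv_one, one_mul,
          mul_one, sub_self, norm_zero]
        positivity
    refine ⟨fun x => ?_, fun x κ => ?_⟩
    · show ‖((expUnit (μc x) : 𝔸ˣ) : 𝔸) - 1‖ ≤ 4 * α₄
      rw [val_expUnit]
      exact (B7Eq214.ineq176_of_207 _ hα₄' (hb x)).le
    · show ‖((((expUnit (μc x))⁻¹ * Rc (U₀c x κ) (expUnit (μc (x + e κ))) : 𝔸ˣ)) : 𝔸) - 1‖ ≤ 4 * α₄ * ((L : ℝ) ^ j)⁻¹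
      rw [Units.val_mul, val_inv_expUnit, val_Rc_eq_cj, val_expUnit, val_expUnit, cj_apply]
      exact (B7Eq214.ineq177_of_207 _ _ _ hα₄' hη1 (hb x) (ha x κ)).le
  obtain ⟨hVl, hPl⟩ := levels_of52 hL hG hU₀c j hα hα3 hα2 h52c
  have hΛprod := inLambda_mul_of_prop10_general hL (fun i hi => hVl i hi.le) (fun i hi => hPl i hi.le) h176 h177 hW hη hk hα.le hα₃
    hα₃' (by positivity) hs₁ hs₂ hs₃ hs₄ hs₅ hs₆
  have hP10 := prop10_general_of52 hL hG hU₀c hα hα3 hα2 h52c h176 h177 hW hα₃ hα₃' (by positivity) hs₁ hs₂ hs₃ hs₄ hs₅ hs₆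
  have h204 : ∀ i ≤ j, ∀ x : Site d, ‖((utilG L U₀c (fun x => expUnit (μc x)) ut i x : 𝔸ˣ) : 𝔸) - 1‖ ≤ 1 / 8 :=
    fun i hi x => ((hP10 i hi).2 x).trans h204w
  have hsβ : α₃ * (L : ℝ) ^ j * ((L : ℝ) ^ j)⁻¹ ≤ 1 / 4 := by
    rw [mul_assoc, mul_inv_cancel₀ hLj.ne', mul_one]; linarith
  have hsβ' : 2 * C6 d * (α₃ + 4 * α₄) * (L : ℝ) ^ j * ((L : ℝ) ^ j)⁻¹ ≤ 1 / 8 := by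
    rw [mul_assoc, mul_inv_cancel₀ hLj.ne', mul_one]; exact hprod
  -- the GLOBAL law for the clamped data
  have hglob := Cnl_negStar hV hut hW.2 hΛprod.2 hL1 hη hα₃ (by positivity) hsβ hsβ' h204 m (by omega) z
  -- transfer to the original data on the tower
  have hC : ∀ {ν νc : Site d → 𝔸}, (∀ x : Site d, tlo L y j ≤ x → x ≤ thi L y j → ν x = νc x) →
      Cnl L U₀ u m ν z = Cnl L U₀c ut m νc z := by
    intro ν νc hν
    have hu' : ∀ x : Site d, tlo L y j ≤ x → x ≤ thi L y j → (fun x => expUnit (ν x)) x = (fun x => expUnit (νc x)) x :=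
      fun x hx hx' => by simp only [hν x hx hx']
    simp only [Cnl, Qnl_eq_mlog_utilG]
    rw [qprimeIter_bgT_eq_lamAvgG L U₀ ν m, qprimeIter_bgT_eq_lamAvgG L U₀c νc m,
      utilG_congr_tower hL1 h₀ hu' hu m n hmn z hz hz', lamAvgG_congr_tower hL1 h₀ hν m n hmn z hz hz']
  have hμ : ∀ x : Site d, tlo L y j ≤ x → x ≤ thi L y j → μ x = μc x :=
    fun x hx hx' => by simp only [hμc_def, clamp_of_inBox (inBox_of_le hx hx')]
  have hμ' : ∀ x : Site d, tlo L y j ≤ x → x ≤ thi L y j → (fun x => -star (μ x)) x = (fun x => -star (μc x)) x :=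
    fun x hx hx' => by simp only [hμ x hx hx']
  rw [hC hμ', hC hμ]
  exact hglob

/-- **A UNITARY `Λ_j`-WITNESS FOR `(glev_j)⁻¹`** (`witness_unitary_of_glev` inverted, keeping the unitarity that `B8SectEInLambdaWitness.witness_inv_of_glev`
does not export): for `u₁ = glev_j` on `Bʲ(y)` (unitary data, windows as there), `u₁⁻¹` agrees on `Bʲ(y)` with a global UNITARY member of
`Λ_j(π^*U₀, 40d·c)`. [cite: Balaban1985RegularSpaces, (1.112) p.95; Balaban1985Averaging, (106) p.33, (166)–(167) p.44] -/
theorem witness_inv_unitary_of_glev {c αP : ℝ} {B : Site d → Fin d → 𝔸} (hd : 1 ≤ d) (hL : 2 ≤ L) (hU₀ : ∀ x κ, U₀ x κ ∈ unitaryUnits 𝔸)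
    (hα : 0 < α₀) (hα3 : C0 d * α₀ ≤ 1 / 3) (hα4 : 4 * α₀ ≤ c2' d L)
    (h33 : pdevOn (tlo L y j) (thi L y j) U₀ < α₀ * (((L : ℝ) ^ j)⁻¹) ^ 2) (hc : 0 ≤ c)
    (hsmall : Real.exp (4 * (800 * ((d : ℝ) + 1) ^ 2 * ((d : ℝ) + 4)) * α₀) * (1 + 8 * (131072 * ((d : ℝ) + 1) ^ 2) * c) ≤ 2)
    (hc₃ : 2 * c ≤ c3 d L) (hsm : 2048 * (d : ℝ) * c ≤ 1)
    (hαP : 0 < αP) (hαP3 : C0 d * αP ≤ 1 / 3) (hαP2 : 2 * αP ≤ c2' d L) (hL1 : 1 ≤ L)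
    (hBu : ∀ (x : Site d) (κ : Fin d), expCfg B x κ ∈ unitaryUnits 𝔸)
    (h69 : ∀ (x : Site d) (κ : Fin d), InBox (tlo L y j) (thi L y j) x → InBox (tlo L y j) (thi L y j) (x + e κ) →
      ‖B x κ‖ ≤ c * ((L : ℝ) ^ j)⁻¹)
    (hP : pdevOn (tlo L y j) (thi L y j) (expCfg B * U₀) < αP * (((L : ℝ) ^ j)⁻¹) ^ 2) {u₁ : Site d → 𝔸ˣ}
    (hu₁ : ∀ x : Site d, tlo L y j ≤ x → x ≤ thi L y j → u₁ x = glev L hL1 U₀ (expCfg B) j 0 x) :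
    ∃ ut' : Site d → 𝔸ˣ, (∀ x, ut' x ∈ unitaryUnits 𝔸) ∧
      InLambda L (clampCfg (tlo L y j) (thi L y j) U₀) ut' j (40 * d * c) (((L : ℝ) ^ j)⁻¹) ∧
      ∀ x : Site d, tlo L y j ≤ x → x ≤ thi L y j → u₁⁻¹ x = ut' x := by
  obtain ⟨ut, hun, hΛ, hag⟩ := witness_unitary_of_glev hd hL hU₀ hα hα3 hα4 h33 hc hsmall hc₃ hsm hαP hαP3 hαP2 hL1 hBu h69 hP hu₁
  have hlohi : ∀ i, tlo L y j i ≤ thi L y j i := B8Ineq130.tlo_le_thi hL1 le_rfl j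
  have hUU : ∀ x κ, U₀ x κ ∈ U1 𝔸 := fun x κ => unitaryUnits_le_U1 (hU₀ x κ)
  have hLj : (0 : ℝ) < (L : ℝ) ^ j := by positivity
  have hU₀c : ∀ x κ, clampCfg (tlo L y j) (thi L y j) U₀ x κ ∈ unitaryUnits 𝔸 := clampCfg_mem hU₀
  have h52c : pdev (clampCfg (tlo L y j) (thi L y j) U₀) < α₀ * (((L : ℝ) ^ j)⁻¹) ^ 2 := (pdev_clampCfg_le hlohi hUU).trans_lt h33
  have hV : ∀ i < j, ∀ (x : Site d) (κ : Fin d), avgIter L (clampCfg (tlo L y j) (thi L y j) U₀) i x κ ∈ unitaryUnits 𝔸 :=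
    fun i hi x κ => (prop2_unitaryUnits L hL j _ hU₀c hα hα3 (by linarith) h52c).2 i hi.le x κ
  have h40 : 40 * (d : ℝ) * c ≤ 1 / 4 := by
    have hd' : (0 : ℝ) ≤ d := by positivity
    nlinarith [hsm, hc, hd']
  have hs : 40 * (d : ℝ) * c * (L : ℝ) ^ j * ((L : ℝ) ^ j)⁻¹ ≤ 1 / 4 := by
    rw [mul_assoc, mul_inv_cancel₀ hLj.ne', mul_one]; exact h40
  refine ⟨ut⁻¹, fun x => ?_, inLambda_inv hV hun hΛ hL1 (by positivity) (by positivity) hs, fun x hx hx' => ?_⟩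
  · rw [Pi.inv_apply]; exact (unitaryUnits 𝔸).inv_mem (hun x)
  · rw [Pi.inv_apply, Pi.inv_apply, hag x hx hx']

/-- **THE BINDER `hCequiv` OF `B8Prop5JoinSectE.hFP_kLevel_of_sectE` AS A THEOREM**: for Theorem 4's inductive `u₁` (`U₁^{u₁}U₀ ∈ Ax_k(𝔅_k, U₀)`
and (1.29): `InAx`, `Restr129`; `U₁ = e^{B}` unitary-valued with (1.69) on the towers; `U₀` unitary with (1.33) on the towers; the full
gauge-fixed field's regularity `αP`; windows), at every `j ≤ k`, `y ∈ Λ_j` and every `μ` in the (1.120)-set of the tower `Bʲ(y)`: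
`C′_j(u₁⁻¹, −μ⋆)(y) = −C′_j(u₁⁻¹, μ)(y)⋆`. [cite: Balaban1985RegularSpaces, (1.115) p.96, (1.120) p.96, p.93, (1.112) p.95; Balaban1985Averaging, Prop. 10 p.50] -/
theorem Cnl_negStar_inv_of_axial {k : ℕ} (Λ : ℕ → Set (Site d)) {c αP : ℝ} {B : Site d → Fin d → 𝔸} {u₁ : Site d → 𝔸ˣ}
    (hd : 1 ≤ d) (hL : 2 ≤ L) (hL1 : 1 ≤ L) (hU₀ : ∀ x κ, U₀ x κ ∈ unitaryUnits 𝔸)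
    (hα : 0 < α₀) (hα3 : C0 d * α₀ ≤ 1 / 3) (hα4 : 4 * α₀ ≤ c2' d L) (hc : 0 ≤ c) (hα₄ : 0 < α₄)
    (hαP : 0 < αP) (hαP3 : C0 d * αP ≤ 1 / 3) (hαP2 : 2 * αP ≤ c2' d L)
    (hBu : ∀ (x : Site d) (κ : Fin d), expCfg B x κ ∈ unitaryUnits 𝔸)
    (h33 : ∀ j, j ≤ k → ∀ y ∈ Λ j, pdevOn (tlo L y j) (thi L y j) U₀ < α₀ * (((L : ℝ) ^ j)⁻¹) ^ 2)
    (h69 : ∀ j, j ≤ k → ∀ y ∈ Λ j, ∀ (x : Site d) (κ : Fin d), InBox (tlo L y j) (thi L y j) x →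
      InBox (tlo L y j) (thi L y j) (x + e κ) → ‖B x κ‖ ≤ c * ((L : ℝ) ^ j)⁻¹)
    (hP : ∀ j, j ≤ k → ∀ y ∈ Λ j, pdevOn (tlo L y j) (thi L y j) (expCfg B * U₀) < αP * (((L : ℝ) ^ j)⁻¹) ^ 2)
    (hAx : InAx L k Λ U₀ (mgauge U₀ u₁ (expCfg B) * U₀)) (h129 : Restr129 L k Λ U₀ u₁)
    (hsmall : Real.exp (4 * (800 * ((d : ℝ) + 1) ^ 2 * ((d : ℝ) + 4)) * α₀) * (1 + 8 * (131072 * ((d : ℝ) + 1) ^ 2) * c) ≤ 2)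
    (hc₃ : 2 * c ≤ c3 d L) (hsc : 2048 * (d : ℝ) * c ≤ 1) (hα₃' : 40 * d * c ≤ 1 / 50)
    (hs₁ : 10 * C6 d * (4 * α₄) ≤ 1) (hs₂ : 3000 * ((d : ℝ) + 1) * L * (4 * α₄) ≤ 1)
    (hs₃ : C4G d L * (α₀ + 40 * d * c + 4 * α₄) ≤ 1)
    (hs₄ : 1024 * ((d : ℝ) + 1) * ((d : ℝ) + 4) * L ^ 2 * α₀ ≤ 1) (hs₅ : 32 * ((d : ℝ) + 1) ^ 2 * C6 d * L ^ 2 * α₀ ≤ 1)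
    (hs₆ : 16 * d * C5' d * C6 d * (L : ℝ) ^ 2 * α₀ ≤ 1)
    (hprod : 2 * C6 d * (40 * d * c + 4 * α₄) ≤ 1 / 8) (h204w : C6 d * (4 * α₄) ≤ 1 / 8) :
    ∀ j, j ≤ k → ∀ y ∈ Λ j, ∀ μ : Site d → 𝔸,
      (∀ x : Site d, InBox (tlo L y j) (thi L y j) x → ‖μ x‖ < α₄) →
      (∀ (x : Site d) (κ : Fin d), InBox (tlo L y j) (thi L y j) x → InBox (tlo L y j) (thi L y j) (x + e κ) →
        ‖cj (U₀ x κ) (μ (x + e κ)) - μ x‖ < α₄ * ((L : ℝ) ^ j)⁻¹) →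
      Cnl L U₀ u₁⁻¹ j (fun x => -star (μ x)) y = -star (Cnl L U₀ u₁⁻¹ j μ y) := by
  intro j hj y hy μ hμb hμa
  obtain ⟨ut', hun, hW, hag⟩ := witness_inv_unitary_of_glev hd hL hU₀ hα hα3 hα4 (h33 j hj y hy) hc hsmall hc₃ hsc hαP hαP3 hαP2 hL1
    hBu (h69 j hj y hy) (hP j hj y hy) (glev_on_towers_of_axial hL1 Λ hAx h129 j hj y hy)
  have hy₀ : tlo L y 0 ≤ y := by rw [tlo_zero]
  have hy₀' : y ≤ thi L y 0 := by rw [thi_zero]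
  exact Cnl_negStar_of_witness hL hU₀ hα hα3 (by linarith) (h33 j hj y hy) hL1 hun hW hag hα₄ hμb hμa (by positivity) hα₃' hs₁
    hs₂ hs₃ hs₄ hs₅ hs₆ hprod h204w (m := j) (n := 0) (by omega) y hy₀ hy₀'

end Tower

#print axioms Sexp_theta
#print axioms savg_theta
#print axioms R0avg_theta
#print axioms uavg_theta
#print axioms utilG_theta
#print axioms lamAvgG_negStar
#print axioms Cnl_negStar
#print axioms Cnl_negStar_of_witness
#print axioms witness_inv_unitary_of_glev
#print axioms Cnl_negStar_inv_of_axial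

end Literature.MathematicalPhysics.QuantumFieldTheory.Balaban1983to89.B8SectERemainderCovariance

end
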